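/-
Copyright (c) 2026 the pub-hodgecm-mathlib formalisation cell (harness21).  Prover seat hodgecm-mathlib-B-p14 (g35): road «S3-tree» (LEAD F0P3a-plan (g11) WORD T10-2; architect A-p16 (g28)
census «S3» v3 = DEAL SHEET, acting architect F0P3-p01 (g16)), brick T1 «the `U(3)_v` tree», file T1d-C1 = THE NORMAL FORM OF A TYPE-TWO VERTEX; 2026-09-01.
-/
import Literature.NumberTheory.Automorphic.UnitaryLatticeTreeParent   -- ★ T1d-B (B-p14 (g35)): diagonal `ϖ`-power lattices, the parent of a self-dual vertex
import HarnessLib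

/-!
# The lattice graph of a hermitian space — VII: THE NORMAL FORM `κ · t_a · κ″ · N₁` OF A TYPE-TWO VERTEX of the `U(3)` tree (over the transitivity of `U(J₀)` on type-two
# vertices and the Cartan decomposition) — the input of the type-two parent computation (Bruhat–Tits 1972 §10, (4.4.3); Serre, *Trees* II.1.1; Jacobowitz 1962 §8)

Topic `NumberTheory/Automorphic`; namespace `Literature.NumberTheory.Automorphic.UnitaryLatticeTree`.  THEOREMS ONLY (no definition, no instance, no notation, no named fact,
no `sorry`); kernel lane.  Cell `pub/hodgecm-mathlib` (D-0151), crux H413 = `stmt-HodgeConjecture-24833`; road «S3-tree», brick **T1**, sequel of ★ `UnitaryLatticeTreeParent`.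
THE HYPOTHESIS `htr₂` «`U(σ, J₀)` acts transitively on the type-two vertices: every type-two vertex is `u · N₁`, `N₁ = latt diag(1,1,ϖ)`» is the rank-3 analogue of the rank-2 binder (hB)
(★ `HermitianLatticeTreeTransitive.forall_isModularLattice_exists_latt_mul_eq_of_selfDualLocus`); it is Jacobowitz's classification of hermitian lattices of Jordan type `1 ⊥ ϖ·(hyperbolic
plane)` in `(K³, J₀)` and is discharged separately (T1d′).  Under it (and ★ Cartan `UnramifiedLocalConjDatum.exists_cartan_antidiagonal`) every type-two vertex has the NORMAL FORM
`M = κ · t_a · κ″ · N₁` (`κ, κ″ ∈ K₀`, `a ≥ 0`, `t_a = diag(ϖ^a, 1, ϖ^{−a})`); the sequel T1d-C2 computes the parent `M^♯ ⊓ ϖ^{1−m}𝒪³` (`m = depth M`) in the three cases `a = 0`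
(parent `𝒪³`), `a ≥ 1` with `x₂ ∈ 𝔪` for `x = κ″e₀` (then `κ″N₁ = N₁`, `M = κ·L′_a`, parent `κ·L_{a−1}`), `a ≥ 1` with `x₂` a unit (a child of `κ·L_a`: depth `a+1`, parent `κ·L_a`),
using the §20 plumbing (membership in `κ″·N₁` through `x = κ″e₀`, `x` exactly isotropic and primitive).
HONEST LABEL: HC_CM is proved only modulo the 2 remaining named inputs (hLiu418 24832, h413 24833) until rung 0 closes; nothing printed is asserted here (elementary lattice
algebra over a valuation ring); S3 stays a print row until the road's END lands.

* §20 plumbing: `mapGL_latt_eq` (`g·latt A = latt (gA)`), **`latt_le_iff_forall_mulVec_single_mem`** (columns generate), `scaleLattice_pow_succ_stdLattice_le`, depth bounds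
  `latticeDepth_le_of_le` ∕ `le_latticeDepth_of_forall` ∕ `scaleLattice_latticeDepth_le`, `scaleLattice_stdLattice_le_N₁_le` (`ϖ𝒪³ ≤ N₁ ≤ 𝒪³`), **`mem_mapGL_N₁_iff`** (`y ∈ κ″·N₁ ↔
  |B₀ (κ″e₀) y| ≤ |ϖ|` for `y ∈ 𝒪³`), **`firstColumn_props`** (`κ″e₀` integral, exactly isotropic, primitive).
* §21 `exists_unitaryInt_coe_eq_diagonal`, `weylLongU_mem_unitaryInt`, `mapGL_weylLongU_latt_diagonal_mul`, **`exists_normalForm_of_type_two`** (`htr₂` + ★ Cartan ⇒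
  `M = κ · latt (diag(ϖ^a,1,ϖ^{−a}) · K″ · diag(1,1,ϖ))`, `κ, κ″ ∈ K₀`, `a : ℕ`).

## References
* [BruhatTits1972] F. Bruhat, J. Tits, *Groupes réductifs sur un corps local I*, Publ. Math. IHÉS 41 (1972), §10; (4.4.3) (Cartan decomposition).
* [Tits1979] J. Tits, *Reductive groups over local fields*, PSPM 33.1 (1979), §3.3.3.
* [Serre1980Trees] J.-P. Serre, *Trees* (1980), Ch. II §1.1.
* [Jacobowitz1962] R. Jacobowitz, *Hermitian forms over local fields*, Amer. J. Math. 84 (1962), §7–§8 (classification by Jordan type — the hypothesis `htr₂`).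
-/

set_option autoImplicit false

noncomputable section

open scoped Valued WithZero Matrix MatrixGroups

namespace Literature.NumberTheory.Automorphic.UnitaryLatticeTree

open Literature.NumberTheory.Automorphic Literature.NumberTheory.Automorphic.HermitianLattice
open Literature.NumberTheory.Automorphic.CartanUnique

variable {K : Type*} [Field K] [Valued K ℤᵐ⁰] {σ : K →+* K} {ϖ : K} {N : ℕ}

/-! ## §20 Plumbing: translated column lattices, generation by columns, depth bounds, the standard type-two vertex `N₁` -/

/-- `g · latt A = latt (g A)` for `g ∈ GL_N(K)`. [cite: Serre1980Trees, II.1.1] -/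
theorem mapGL_latt_eq (g : GL (Fin N) K) (A : Matrix (Fin N) (Fin N) K) : mapGL g (latt A) = latt ((g : Matrix (Fin N) (Fin N) K) * A) := by
  rw [mapGL, latt_mul]

/-- **A column lattice is contained in a submodule iff its columns are**: `latt A ≤ M ↔ ∀ j, A e_j ∈ M`. [cite: Serre1980Trees, II.1.1] -/
theorem latt_le_iff_forall_mulVec_single_mem (A : Matrix (Fin N) (Fin N) K) (M : Submodule 𝒪[K] (Fin N → K)) :
    latt A ≤ M ↔ ∀ j, A.mulVec (Pi.single j 1) ∈ M := by
  constructor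
  · exact fun h j => h (mulVec_single_mem_latt A j)
  · intro h x hx
    obtain ⟨u, hu, rfl⟩ := Submodule.mem_map.1 hx
    rw [LinearMap.restrictScalars_apply, Matrix.toLin'_apply]
    have hsum : A.mulVec u = ∑ j, (⟨u j, (mem_integer_iff' _).2 (hu j)⟩ : 𝒪[K]) • A.mulVec (Pi.single j 1) := by
      conv_lhs => rw [show u = ∑ j, u j • (Pi.single j (1 : K) : Fin N → K) from by
        funext i; simp [Finset.sum_apply, Pi.single_apply]]
      rw [Matrix.mulVec_sum]
      refine Finset.sum_congr rfl fun j _ => ?_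
      rw [Matrix.mulVec_smul]; rfl
    rw [hsum]
    exact Submodule.sum_mem _ fun j _ => Submodule.smul_mem _ _ (h j)

/-- `ϖ^{k+1}·𝒪^N = ϖ·(ϖ^k·𝒪^N)` as an inequality of scaled roots: `ϖ^{k+1}𝒪^N ≤ ϖ·M` whenever `ϖ^k𝒪^N ≤ M`. [cite: Serre1980Trees, II.1.1] -/
theorem scaleLattice_pow_succ_stdLattice_le {M : Submodule 𝒪[K] (Fin N → K)} {k : ℕ} (h : scaleLattice (ϖ ^ k) (stdLattice K N) ≤ M) :
    scaleLattice (ϖ ^ (k + 1)) (stdLattice K N) ≤ scaleLattice ϖ M := by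
  intro x hx
  obtain ⟨y, hy, rfl⟩ := Submodule.mem_map.1 hx
  refine Submodule.mem_map.2 ⟨(ϖ ^ k) • y, h (Submodule.mem_map.2 ⟨y, hy, rfl⟩), ?_⟩
  simp only [LinearMap.restrictScalars_apply, LinearMap.smul_apply, LinearMap.id_apply, smul_smul, pow_succ, mul_comm]

/-- **Depth upper bound**: `ϖ^k𝒪^N ≤ M ⇒ depth M ≤ k`. [cite: Serre1980Trees, II.1.1] -/
theorem latticeDepth_le_of_le {M : Submodule 𝒪[K] (Fin N → K)} {k : ℕ} (h : scaleLattice (ϖ ^ k) (stdLattice K N) ≤ M) : latticeDepth ϖ M ≤ k :=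
  Nat.sInf_le h

/-- **Depth lower bound**: if every `j` with `ϖ^j𝒪^N ≤ M` satisfies `k ≤ j`, and some such `j` exists, then `k ≤ depth M`. [cite: Serre1980Trees, II.1.1] -/
theorem le_latticeDepth_of_forall {M : Submodule 𝒪[K] (Fin N → K)} {k j₀ : ℕ} (hj₀ : scaleLattice (ϖ ^ j₀) (stdLattice K N) ≤ M)
    (h : ∀ j : ℕ, scaleLattice (ϖ ^ j) (stdLattice K N) ≤ M → k ≤ j) : k ≤ latticeDepth ϖ M :=
  le_csInf ⟨j₀, hj₀⟩ fun j hj => h j hj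

/-- The depth witness: `ϖ^{depth M}𝒪^N ≤ M` as soon as some `ϖ^j𝒪^N ≤ M`. [cite: Serre1980Trees, II.1.1] -/
theorem scaleLattice_latticeDepth_le {M : Submodule 𝒪[K] (Fin N → K)} {j₀ : ℕ} (hj₀ : scaleLattice (ϖ ^ j₀) (stdLattice K N) ≤ M) :
    scaleLattice (ϖ ^ latticeDepth ϖ M) (stdLattice K N) ≤ M :=
  Nat.sInf_mem (s := {k : ℕ | scaleLattice (ϖ ^ k) (stdLattice K N) ≤ M}) ⟨j₀, hj₀⟩

/-- `N₁ = latt diag(1,1,ϖ)` lies between `ϖ𝒪³` and `𝒪³` (`|ϖ| ≤ 1`, `ϖ ≠ 0`). [cite: Serre1980Trees, II.1.1] -/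
theorem scaleLattice_stdLattice_le_N₁_le (hϖ1 : Valued.v ϖ ≤ 1) (hϖ0 : ϖ ≠ 0) :
    scaleLattice ϖ (stdLattice K 3) ≤ latt (Matrix.diagonal ![(1 : K), 1, ϖ]) ∧ latt (Matrix.diagonal ![(1 : K), 1, ϖ]) ≤ stdLattice K 3 := by
  have hd : ∀ i, (![(1 : K), 1, ϖ] : Fin 3 → K) i ≠ 0 := by intro i; fin_cases i <;> simp [hϖ0]
  constructor
  · intro x hx
    rw [mem_scaleLattice_stdLattice_iff hϖ0] at hx
    refine (mem_latt_diagonal_iff hd x).2 fun i => ?_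
    fin_cases i <;> simp only [Fin.zero_eta, Fin.mk_one, Fin.reduceFinMk, Matrix.cons_val_zero, Matrix.cons_val_one, Matrix.cons_val_two, Matrix.tail_cons, Matrix.head_cons,
      Nat.succ_eq_add_one, map_one]
    · exact (hx 0).trans hϖ1
    · exact (hx 1).trans hϖ1
    · exact hx 2
  · refine (latt_le_stdLattice_iff _).2 fun i j => ?_
    rw [Matrix.diagonal_apply]
    split_ifs with h
    · subst h; fin_cases i <;> simp [hϖ1]
    · simp

/-- **Membership in `κ″·N₁` through the first column `x = κ″e₀`**: for `κ″ ∈ K₀` and `y ∈ 𝒪³`, `y ∈ κ″·N₁ ↔ |B₀ x y| ≤ |ϖ|` (unitarity: `B₀(κ″e₀, y) = (κ″⁻¹y)₂`). [cite: BruhatTits1972, §10] -/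
theorem mem_mapGL_N₁_iff {κ : unitaryGroupOfForm σ ((StdForm.antidiagonal 3).over K)} (hκ : κ ∈ unitaryInt σ ((StdForm.antidiagonal 3).over K)) (hϖ0 : ϖ ≠ 0)
    {y : Fin 3 → K} (hy : y ∈ stdLattice K 3) :
    y ∈ mapGL (κ : GL (Fin 3) K) (latt (Matrix.diagonal ![(1 : K), 1, ϖ])) ↔
      Valued.v (B₀ σ 3 (((κ : GL (Fin 3) K) : Matrix (Fin 3) (Fin 3) K).mulVec (Pi.single 0 1)) y) ≤ Valued.v ϖ := by
  have hd : ∀ i, (![(1 : K), 1, ϖ] : Fin 3 → K) i ≠ 0 := by intro i; fin_cases i <;> simp [hϖ0]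
  have hy' : (((κ⁻¹ : unitaryGroupOfForm σ ((StdForm.antidiagonal 3).over K)) : GL (Fin 3) K) : Matrix (Fin 3) (Fin 3) K).mulVec y ∈ stdLattice K 3 :=
    mulVec_mem_stdLattice_of_mem_unitaryInt_inv hκ hy
  rw [mem_mapGL_iff, B₀_mulVec_eq_B₀_inv_mulVec, B₀_single_left, ← Subgroup.coe_inv, mem_latt_diagonal_iff hd]
  rw [show Fin.rev (0 : Fin 3) = 2 from rfl]
  constructor
  · intro h; have := h 2; simpa using this
  · intro h i
    fin_cases i <;> simp only [Fin.zero_eta, Fin.mk_one, Fin.reduceFinMk, Matrix.cons_val_zero, Matrix.cons_val_one, Matrix.cons_val_two, Matrix.tail_cons, Matrix.head_cons,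
      Nat.succ_eq_add_one, map_one]
    · exact hy' 0
    · exact hy' 1
    · exact h

/-- The first column `x = κ″e₀` of an element of `K₀` is integral, EXACTLY ISOTROPIC, and has a unit coordinate. [cite: BruhatTits1972, §10] -/
theorem firstColumn_props {κ : unitaryGroupOfForm σ ((StdForm.antidiagonal 3).over K)} (hκ : κ ∈ unitaryInt σ ((StdForm.antidiagonal 3).over K)) :
    ((κ : GL (Fin 3) K) : Matrix (Fin 3) (Fin 3) K).mulVec (Pi.single 0 1) ∈ stdLattice K 3 ∧
      B₀ σ 3 (((κ : GL (Fin 3) K) : Matrix (Fin 3) (Fin 3) K).mulVec (Pi.single 0 1)) (((κ : GL (Fin 3) K) : Matrix (Fin 3) (Fin 3) K).mulVec (Pi.single 0 1)) = 0 ∧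
      ∃ i, Valued.v (((κ : GL (Fin 3) K) : Matrix (Fin 3) (Fin 3) K).mulVec (Pi.single 0 1) i) = 1 := by
  refine ⟨mulVec_mem_stdLattice_of_mem_unitaryInt hκ (single_mem_stdLattice 0), ?_, ?_⟩
  · rw [(mem_unitaryGroupOfForm_antidiagonal_iff (κ : GL (Fin 3) K)).1 κ.2, B₀_single_left, show Fin.rev (0 : Fin 3) = 2 from rfl]
    simp
  · by_contra hne
    push Not at hne
    have hlt : ∀ i, Valued.v (((κ : GL (Fin 3) K) : Matrix (Fin 3) (Fin 3) K).mulVec (Pi.single 0 1) i) < 1 :=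
      fun i => lt_of_le_of_ne (mulVec_mem_stdLattice_of_mem_unitaryInt hκ (single_mem_stdLattice 0) i) (hne i)
    -- `e₀ = κ⁻¹ (κ e₀)` would then have all coordinates of valuation `< 1`
    have hinv := (mem_unitaryInt_iff.1 hκ).2
    have h0 : Valued.v ((((κ : GL (Fin 3) K)⁻¹ : GL (Fin 3) K) : Matrix (Fin 3) (Fin 3) K).mulVec
        (((κ : GL (Fin 3) K) : Matrix (Fin 3) (Fin 3) K).mulVec (Pi.single 0 1)) 0) < 1 := by
      rw [Matrix.mulVec, dotProduct]
      refine Valuation.map_sum_lt _ one_ne_zero fun j _ => ?_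
      rw [map_mul]
      calc Valued.v ((((κ : GL (Fin 3) K)⁻¹ : GL (Fin 3) K) : Matrix (Fin 3) (Fin 3) K) 0 j) *
            Valued.v (((κ : GL (Fin 3) K) : Matrix (Fin 3) (Fin 3) K).mulVec (Pi.single 0 1) j) ≤
            1 * Valued.v (((κ : GL (Fin 3) K) : Matrix (Fin 3) (Fin 3) K).mulVec (Pi.single 0 1) j) := mul_le_mul' (hinv 0 j) le_rfl
        _ < 1 := by rw [one_mul]; exact hlt j
    rw [Matrix.mulVec_mulVec, ← Units.val_mul, inv_mul_cancel, Units.val_one, Matrix.one_mulVec, Pi.single_eq_same, map_one] at h0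
    exact lt_irrefl _ h0

/-! ## §21 The normal form of a type-two vertex under transitivity: `M = κ · t_a · κ″ · N₁` -/

/-- A `σ`-fixed diagonal matrix `diag(e)` with unit entries and `e_i e_{rev i} = 1` is an element of `K₀`. [cite: Tits1979, §3.3.3] -/
theorem exists_unitaryInt_coe_eq_diagonal (hvσ : ∀ a, Valued.v (σ a) = Valued.v a) {e : Fin 3 → K} (heσ : ∀ i, σ (e i) = e i) (heinv : ∀ i, e i * e (Fin.rev i) = 1)
    (hev : ∀ i, Valued.v (e i) = 1) :
    ∃ D : unitaryGroupOfForm σ ((StdForm.antidiagonal 3).over K), D ∈ unitaryInt σ ((StdForm.antidiagonal 3).over K) ∧ ((D : GL (Fin 3) K) : Matrix (Fin 3) (Fin 3) K) = Matrix.diagonal e := by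
  have hdet : (Matrix.diagonal e).det ≠ 0 := by
    rw [Matrix.det_diagonal]; exact Finset.prod_ne_zero_iff.2 fun i _ h0 => by have := hev i; rw [h0, map_zero] at this; exact zero_ne_one this
  have hmem : Matrix.GeneralLinearGroup.mkOfDetNeZero _ hdet ∈ unitaryGroupOfForm σ ((StdForm.antidiagonal 3).over K) := by
    rw [mem_unitaryGroupOfForm_antidiagonal_iff]
    intro u v
    rw [Matrix.GeneralLinearGroup.val_mkOfDetNeZero]
    exact B₀_diagonal_mulVec heσ heinv u v
  refine ⟨⟨_, hmem⟩, (UnitaryGroup.mem_unitaryInt_iff_forall_v_apply_le_one σ rfl hvσ _).2 fun i j => ?_, Matrix.GeneralLinearGroup.val_mkOfDetNeZero _ _⟩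
  change Valued.v ((Matrix.GeneralLinearGroup.mkOfDetNeZero (Matrix.diagonal e) hdet : Matrix (Fin 3) (Fin 3) K) i j) ≤ 1
  rw [Matrix.GeneralLinearGroup.val_mkOfDetNeZero, Matrix.diagonal_apply]
  split_ifs
  · exact (hev i).le
  · simp

/-- The long Weyl element `w₀ = J₀` lies in `K₀`. [cite: Tits1979, §3.3.3] -/
theorem weylLongU_mem_unitaryInt (hvσ : ∀ a, Valued.v (σ a) = Valued.v a) :
    UnitaryGroup.weylLongU σ (rfl : (StdForm.antidiagonal 3).over K = (StdForm.antidiagonal 3).over K) ∈ unitaryInt σ ((StdForm.antidiagonal 3).over K) := by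
  refine (UnitaryGroup.mem_unitaryInt_iff_forall_v_apply_le_one σ rfl hvσ _).2 fun i j => ?_
  rw [UnitaryGroup.coe_coe_weylLongU]
  simp only [StdForm.over, Matrix.map_apply, StdForm.antidiagonal_J_apply]
  split_ifs <;> simp

/-- `w₀ · latt diag(ϖ^a, ϖ^b, ϖ^c)·? `: conjugating a `ϖ`-power diagonal lattice map by `w₀` reverses the exponents: `w₀ · latt (diag(f) · A) = latt (diag(f ∘ rev) · (w₀ A))`. In the form used
below: `w₀ · (t · X) = t′ · (w₀ · X)` with `t = diag(f)`, `t′ = diag(f ∘ rev)` on lattices. [cite: Tits1979, §3.3.3] -/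
theorem mapGL_weylLongU_latt_diagonal_mul (f : Fin 3 → K) (A : Matrix (Fin 3) (Fin 3) K) :
    mapGL (UnitaryGroup.weylLongU σ (rfl : (StdForm.antidiagonal 3).over K = (StdForm.antidiagonal 3).over K) : GL (Fin 3) K) (latt (Matrix.diagonal f * A)) =
      latt (Matrix.diagonal (fun i => f (Fin.rev i)) * ((StdForm.antidiagonal 3).over K * A)) := by
  rw [mapGL_latt_eq, UnitaryGroup.coe_coe_weylLongU, ← Matrix.mul_assoc, antidiagonal_mul_diagonal, Matrix.mul_assoc]

/-- **NORMAL FORM OF A TYPE-TWO VERTEX** (`N = 3`, `UnramifiedLocalConjDatum σ ϖ`, transitivity `htr₂`): `M = κ · latt (diag(ϖ^a,1,ϖ^{−a}) · K″ · diag(1,1,ϖ))` with `κ, κ″ ∈ K₀`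
(matrix `K″`) and `a : ℕ` — from `M = u·N₁`, ★ Cartan `u = k₁⁻¹·diag(d)·k₂⁻¹`, `diag(d) = t_{−m}·diag(units)`, and a `w₀`-flip when `−m < 0`. [cite: BruhatTits1972, (4.4.3) and §10] -/
theorem exists_normalForm_of_type_two (hd : UnramifiedLocalConjDatum σ ϖ)
    (htr₂ : ∀ M : Submodule 𝒪[K] (Fin 3 → K), IsVertexLattice σ ϖ ((StdForm.antidiagonal 3).over K) 2 M →
      ∃ u : unitaryGroupOfForm σ ((StdForm.antidiagonal 3).over K), M = mapGL (u : GL (Fin 3) K) (latt (Matrix.diagonal ![(1 : K), 1, ϖ])))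
    {M : Submodule 𝒪[K] (Fin 3 → K)} (hM : IsVertexLattice σ ϖ ((StdForm.antidiagonal 3).over K) 2 M) :
    ∃ κ : unitaryGroupOfForm σ ((StdForm.antidiagonal 3).over K), κ ∈ unitaryInt σ ((StdForm.antidiagonal 3).over K) ∧
    ∃ κ'' : unitaryGroupOfForm σ ((StdForm.antidiagonal 3).over K), κ'' ∈ unitaryInt σ ((StdForm.antidiagonal 3).over K) ∧
    ∃ a : ℕ, M = mapGL (κ : GL (Fin 3) K) (latt (Matrix.diagonal ![ϖ ^ (a : ℤ), 1, ϖ ^ (-(a : ℤ))] *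
      (((κ'' : GL (Fin 3) K) : Matrix (Fin 3) (Fin 3) K) * Matrix.diagonal ![(1 : K), 1, ϖ]))) := by
  have hϖ0 : ϖ ≠ 0 := uniformizer_ne_zero hd.vϖ
  obtain ⟨u, rfl⟩ := htr₂ M hM
  obtain ⟨k₁, k₂, hk₁U, hk₁, hk₁', hk₂U, hk₂, hk₂', d, hdiag, hdσ, hdinv⟩ := hd.exists_cartan_antidiagonal (u : GL (Fin 3) K) u.2
  -- the unit part of `diag(d)` and the exponent `m`
  have hd0 : ∀ i, d i ≠ 0 := fun i h => by have := hdinv i; rw [h, zero_mul] at this; exact zero_ne_one this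
  set m : ℤ := WithZero.log (Valued.v (d 0)) with hm
  have hd0v : Valued.v (d 0) = WithZero.exp m := by rw [hm, WithZero.exp_log ((Valuation.ne_zero_iff _).2 (hd0 0))]
  have hd1 : Valued.v (d 1) = 1 := by
    have h11 : d 1 * d 1 = 1 := by have := hdinv 1; rwa [show Fin.rev (1 : Fin 3) = 1 from rfl] at this
    obtain ⟨m1, hm1⟩ : ∃ m1 : ℤ, Valued.v (d 1) = WithZero.exp m1 := ⟨_, (WithZero.exp_log ((Valuation.ne_zero_iff _).2 (hd0 1))).symm⟩
    have hv : Valued.v (d 1) * Valued.v (d 1) = 1 := by rw [← map_mul, h11, map_one]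
    rw [hm1, ← WithZero.exp_add, ← WithZero.exp_zero, WithZero.exp_inj] at hv
    rw [hm1, show m1 = 0 by omega, WithZero.exp_zero]
  have hd2 : Valued.v (d 2) = WithZero.exp (-m) := by
    have h02 : d 0 * d 2 = 1 := by have := hdinv 0; rwa [show Fin.rev (0 : Fin 3) = 2 from rfl] at this
    have hv : Valued.v (d 0) * Valued.v (d 2) = 1 := by rw [← map_mul, h02, map_one]
    rw [hd0v] at hv
    rw [WithZero.exp_neg, ← mul_eq_one_iff_eq_inv₀ WithZero.coe_ne_zero, mul_comm, hv]
  -- `e := (d₀ ϖ^m, d₁, d₂ ϖ^{-m})` units, `σ`-fixed, `e_i e_{rev i} = 1`; `diag d = diag(ϖ^{-m},1,ϖ^{m}) · diag e`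
  set e : Fin 3 → K := ![d 0 * ϖ ^ m, d 1, d 2 * ϖ ^ (-m)] with he
  have heσ : ∀ i, σ (e i) = e i := by
    intro i; fin_cases i <;> simp [he, map_mul, map_zpow₀, hdσ, hd.σϖ]
  have heinv : ∀ i, e i * e (Fin.rev i) = 1 := by
    intro i; fin_cases i
    · show (d 0 * ϖ ^ m) * (d 2 * ϖ ^ (-m)) = 1
      have := hdinv 0; rw [show Fin.rev (0 : Fin 3) = 2 from rfl] at this
      rw [mul_mul_mul_comm, this, one_mul, ← zpow_add₀ hϖ0, add_neg_cancel, zpow_zero]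
    · show d 1 * d 1 = 1
      have := hdinv 1; rwa [show Fin.rev (1 : Fin 3) = 1 from rfl] at this
    · show (d 2 * ϖ ^ (-m)) * (d 0 * ϖ ^ m) = 1
      have := hdinv 2; rw [show Fin.rev (2 : Fin 3) = 0 from rfl] at this
      rw [mul_mul_mul_comm, this, one_mul, ← zpow_add₀ hϖ0, neg_add_cancel, zpow_zero]
  have hev : ∀ i, Valued.v (e i) = 1 := by
    intro i; fin_cases i
    · show Valued.v (d 0 * ϖ ^ m) = 1
      rw [map_mul, hd0v, v_uniformizer_zpow hd.vϖ, ← WithZero.exp_add, add_neg_cancel, WithZero.exp_zero]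
    · exact hd1
    · show Valued.v (d 2 * ϖ ^ (-m)) = 1
      rw [map_mul, hd2, v_uniformizer_zpow hd.vϖ, ← WithZero.exp_add, neg_neg, neg_add_cancel, WithZero.exp_zero]
  obtain ⟨D, hD, hDe⟩ := exists_unitaryInt_coe_eq_diagonal hd.vσ heσ heinv hev
  have hde : Matrix.diagonal d = Matrix.diagonal ![ϖ ^ (-m), (1 : K), ϖ ^ m] * Matrix.diagonal e := by
    rw [diagonal_three_mul]
    congr 1; funext i; fin_cases i
    · show d 0 = ϖ ^ (-m) * (d 0 * ϖ ^ m)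
      rw [mul_comm, mul_assoc, ← zpow_add₀ hϖ0, add_neg_cancel, zpow_zero, mul_one]
    · show d 1 = 1 * d 1; rw [one_mul]
    · show d 2 = ϖ ^ m * (d 2 * ϖ ^ (-m))
      rw [mul_comm, mul_assoc, ← zpow_add₀ hϖ0, neg_add_cancel, zpow_zero, mul_one]
  -- the `K₀`-elements `κ₁ := k₁⁻¹`, `κ₂ := D·k₂⁻¹`
  let K1 : unitaryGroupOfForm σ ((StdForm.antidiagonal 3).over K) := ⟨k₁, hk₁U⟩⁻¹
  have hK1 : K1 ∈ unitaryInt σ ((StdForm.antidiagonal 3).over K) := by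
    refine Subgroup.inv_mem _ (mem_unitaryInt_iff.2 ⟨hk₁, hk₁'⟩)
  let K2 : unitaryGroupOfForm σ ((StdForm.antidiagonal 3).over K) := D * ⟨k₂, hk₂U⟩⁻¹
  have hK2 : K2 ∈ unitaryInt σ ((StdForm.antidiagonal 3).over K) :=
    Subgroup.mul_mem _ hD (Subgroup.inv_mem _ (mem_unitaryInt_iff.2 ⟨hk₂, hk₂'⟩))
  -- `u = k₁⁻¹ · diag d · k₂⁻¹` as matrices
  have hu : ((u : GL (Fin 3) K) : Matrix (Fin 3) (Fin 3) K) =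
      ((K1 : GL (Fin 3) K) : Matrix (Fin 3) (Fin 3) K) * (Matrix.diagonal ![ϖ ^ (-m), (1 : K), ϖ ^ m] * (((K2 : GL (Fin 3) K) : Matrix (Fin 3) (Fin 3) K))) := by
    have h1 : ((K1 : GL (Fin 3) K) : Matrix (Fin 3) (Fin 3) K) = ((k₁⁻¹ : GL (Fin 3) K) : Matrix (Fin 3) (Fin 3) K) := rfl
    have h2 : ((K2 : GL (Fin 3) K) : Matrix (Fin 3) (Fin 3) K) = Matrix.diagonal e * ((k₂⁻¹ : GL (Fin 3) K) : Matrix (Fin 3) (Fin 3) K) := by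
      rw [← hDe]; rfl
    rw [h1, h2, ← Matrix.mul_assoc (Matrix.diagonal _), ← hde, ← hdiag, Units.val_mul, Units.val_mul]
    rw [show ((k₁⁻¹ : GL (Fin 3) K) : Matrix (Fin 3) (Fin 3) K) * ((k₁ : Matrix (Fin 3) (Fin 3) K) * (u : GL (Fin 3) K) * (k₂ : Matrix (Fin 3) (Fin 3) K) *
        ((k₂⁻¹ : GL (Fin 3) K) : Matrix (Fin 3) (Fin 3) K)) = (((k₁⁻¹ * k₁ * u * k₂ * k₂⁻¹ : GL (Fin 3) K)) : Matrix (Fin 3) (Fin 3) K) by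
      simp only [Units.val_mul, Matrix.mul_assoc]]
    rw [inv_mul_cancel, one_mul, mul_assoc, mul_inv_cancel, mul_one]
  -- sign of the exponent
  rcases le_or_gt m 0 with hm0 | hm0
  · refine ⟨K1, hK1, K2, hK2, (-m).toNat, ?_⟩
    rw [mapGL_latt_eq, hu, Matrix.mul_assoc, ← mapGL_latt_eq, Matrix.mul_assoc, show ((-m).toNat : ℤ) = -m by omega, neg_neg]
  · -- flip with `w₀ ∈ K₀`: `K1·t_{-m}·K2·N₁ = (K1 w₀)·t_m·(w₀ K2)·N₁`
    set w₀ := UnitaryGroup.weylLongU σ (rfl : (StdForm.antidiagonal 3).over K = (StdForm.antidiagonal 3).over K) with hw₀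
    have hw₀K := weylLongU_mem_unitaryInt (K := K) hd.vσ
    refine ⟨K1 * w₀, Subgroup.mul_mem _ hK1 hw₀K, w₀ * K2, Subgroup.mul_mem _ hw₀K hK2, m.toNat, ?_⟩
    have hW : ((w₀ : GL (Fin 3) K) : Matrix (Fin 3) (Fin 3) K) = (StdForm.antidiagonal 3).over K := by rw [hw₀, UnitaryGroup.coe_coe_weylLongU]
    have hWT : (StdForm.antidiagonal 3).over K * Matrix.diagonal ![ϖ ^ m, (1 : K), ϖ ^ (-m)] * (StdForm.antidiagonal 3).over K = Matrix.diagonal ![ϖ ^ (-m), (1 : K), ϖ ^ m] := by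
      rw [antidiagonal_mul_diagonal, Matrix.mul_assoc, StdForm.over_mul_over, Matrix.mul_one]
      congr 1; funext i; fin_cases i <;> rfl
    rw [show ((m.toNat : ℤ)) = m by omega, Subgroup.coe_mul, mapGL_mul, Subgroup.coe_mul, Units.val_mul, hW, mapGL_latt_eq (u : GL (Fin 3) K), hu,
      mapGL_latt_eq (w₀ : GL (Fin 3) K), hW, mapGL_latt_eq (K1 : GL (Fin 3) K)]
    congr 1
    rw [← hWT]
    simp only [Matrix.mul_assoc]

end Literature.NumberTheory.Automorphic.UnitaryLatticeTree

end
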